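import Mathlib
import Literature.NumberTheory.DiophantineGeometry.SchurWeylPlethysm
import Literature.Computability.AlgebraicComplexity.OrbitClosure
import Literature.Computability.AlgebraicComplexity.StandardFamilies

/-!
# The diagonal two-letter pencil of the padded permanent
(explicit highest-weight-vector axis of `stub_seedRichness`, crux `ValuativeGCT.ValuativeFlip`,
stmt-ValiantsHypothesis-12624; wall-breaker k1)

The family of points of the endomorphism orbit `End(W) · X₀₀^{m-n} per_n` on which the two-row
Tschirnhaus seeds are evaluated: for two letters `x ≠ y` of `MatIdx m` and parameters
`a_t` (`t` in the bottom-right block `BlockIdx n m`, the variables of `A = ℂ[a_t]`), the matrix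
`P = P(x, y)` with entries in `A` substitutes

  `X₀₀ ↦ X_x`, `X_tt ↦ X_x + a_t X_y` (block diagonal), every other variable `↦ 0`,

so that `P · (X₀₀^{m-n} per_n) = X_x^{m-n} ∏_t (X_x + a_t X_y)` (`pp_linSubst_pencil`: the permanent of
a diagonal matrix is the product of its diagonal, Mathlib `Matrix.permanent_diagonal`), a binary form in
`(y, x)` whose coefficients are the elementary symmetric polynomials `e_j(a)` (`pp_coeff_pencil`).

No definitions and no notation (the matrix `P` is written out with `Matrix.of`).
-/

set_option linter.dupNamespace false

namespace Summit.ValiantsHypothesis.ValiantsHypothesis.Theorems.ValuativeFlip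

open MvPolynomial Literature.NumberTheory.DiophantineGeometry
open Literature.Computability.AlgebraicComplexity
open scoped BigOperators

noncomputable section

/-! ## The pencil substitution on variables -/

/-- Columns of the pencil matrix: the substitution sends `X_w` to `P_xw X_x + P_yw X_y`. [folklore] -/
theorem pp_linSubst_pencil_X {n m : ℕ} {x y : MatIdx m} (hyx : y ≠ x) (w : MatIdx m) :
    linSubst (MatIdx m) (MvPolynomial (BlockIdx n m) ℂ) (Matrix.of fun v w : MatIdx m =>
        if v = x then (if (ofLex w).1 = (ofLex w).2 then (1 : (MvPolynomial (BlockIdx n m) ℂ)) else 0)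
        else if v = y then (if h : (ofLex w).1 = (ofLex w).2 ∧ m - n ≤ ((ofLex w).1 : ℕ)
          then (X ⟨(ofLex w).1, h.2⟩ : (MvPolynomial (BlockIdx n m) ℂ)) else 0) else 0) (X w) =
      (if (ofLex w).1 = (ofLex w).2 then (1 : (MvPolynomial (BlockIdx n m) ℂ)) else 0) • (X x : MvPolynomial (MatIdx m) (MvPolynomial (BlockIdx n m) ℂ)) +
        (if h : (ofLex w).1 = (ofLex w).2 ∧ m - n ≤ ((ofLex w).1 : ℕ) then (X ⟨(ofLex w).1, h.2⟩ : (MvPolynomial (BlockIdx n m) ℂ))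
          else 0) • (X y : MvPolynomial (MatIdx m) (MvPolynomial (BlockIdx n m) ℂ)) := by
  rw [linSubst_X]
  have hterm : ∀ v : MatIdx m, (Matrix.of fun v w : MatIdx m =>
        if v = x then (if (ofLex w).1 = (ofLex w).2 then (1 : (MvPolynomial (BlockIdx n m) ℂ)) else 0)
        else if v = y then (if h : (ofLex w).1 = (ofLex w).2 ∧ m - n ≤ ((ofLex w).1 : ℕ)
          then (X ⟨(ofLex w).1, h.2⟩ : (MvPolynomial (BlockIdx n m) ℂ)) else 0) else 0) v w •
          (X v : MvPolynomial (MatIdx m) (MvPolynomial (BlockIdx n m) ℂ)) =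
      (if v = x then (if (ofLex w).1 = (ofLex w).2 then (1 : (MvPolynomial (BlockIdx n m) ℂ)) else 0) •
          (X x : MvPolynomial (MatIdx m) (MvPolynomial (BlockIdx n m) ℂ)) else 0) +
        (if v = y then (if h : (ofLex w).1 = (ofLex w).2 ∧ m - n ≤ ((ofLex w).1 : ℕ)
          then (X ⟨(ofLex w).1, h.2⟩ : (MvPolynomial (BlockIdx n m) ℂ)) else 0) • (X y : MvPolynomial (MatIdx m) (MvPolynomial (BlockIdx n m) ℂ))
          else 0) := by
    intro v
    rw [Matrix.of_apply]
    by_cases hvx : v = x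
    · subst hvx
      rw [if_pos rfl, if_pos rfl, if_neg hyx.symm, add_zero]
    · rw [if_neg hvx, if_neg hvx, zero_add]
      by_cases hvy : v = y
      · subst hvy; rw [if_pos rfl, if_pos rfl]
      · rw [if_neg hvy, if_neg hvy, zero_smul]
  simp only [hterm, Finset.sum_add_distrib, Finset.sum_ite_eq', Finset.mem_univ, if_true]

/-! ## The pencil applied to the padded permanent -/

/-- **The diagonal pencil of the padded permanent**: substituting `X₀₀ ↦ X_x`, `X_tt ↦ X_x + a_t X_y`
on the block diagonal and `0` elsewhere turns `X₀₀^{m-n} per_n` (base-changed to `A = ℂ[a_t]`) into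
`X_x^{m-n} ∏_t (X_x + a_t X_y)`. [folklore; Mathlib `Matrix.permanent_diagonal`] -/
theorem pp_linSubst_pencil (n m : ℕ) [NeZero m] {x y : MatIdx m} (hyx : y ≠ x) :
    linSubst (MatIdx m) (MvPolynomial (BlockIdx n m) ℂ) (Matrix.of fun v w : MatIdx m =>
        if v = x then (if (ofLex w).1 = (ofLex w).2 then (1 : (MvPolynomial (BlockIdx n m) ℂ)) else 0)
        else if v = y then (if h : (ofLex w).1 = (ofLex w).2 ∧ m - n ≤ ((ofLex w).1 : ℕ)
          then (X ⟨(ofLex w).1, h.2⟩ : (MvPolynomial (BlockIdx n m) ℂ)) else 0) else 0)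
      (map (algebraMap ℂ (MvPolynomial (BlockIdx n m) ℂ)) (paddedPerFormLex ℂ n m)) =
      (X x : MvPolynomial (MatIdx m) (MvPolynomial (BlockIdx n m) ℂ)) ^ (m - n) *
        ∏ t : BlockIdx n m, ((X x : MvPolynomial (MatIdx m) (MvPolynomial (BlockIdx n m) ℂ)) +
          C (X t : (MvPolynomial (BlockIdx n m) ℂ)) * (X y : MvPolynomial (MatIdx m) (MvPolynomial (BlockIdx n m) ℂ))) := by
  -- name the substitution and the matrix
  set P : Matrix (MatIdx m) (MatIdx m) (MvPolynomial (BlockIdx n m) ℂ) := (Matrix.of fun v w : MatIdx m =>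
        if v = x then (if (ofLex w).1 = (ofLex w).2 then (1 : (MvPolynomial (BlockIdx n m) ℂ)) else 0)
        else if v = y then (if h : (ofLex w).1 = (ofLex w).2 ∧ m - n ≤ ((ofLex w).1 : ℕ)
          then (X ⟨(ofLex w).1, h.2⟩ : (MvPolynomial (BlockIdx n m) ℂ)) else 0) else 0) with hP
  have hX : ∀ w : MatIdx m, linSubst (MatIdx m) (MvPolynomial (BlockIdx n m) ℂ) P (X w) =
      (if (ofLex w).1 = (ofLex w).2 then (1 : (MvPolynomial (BlockIdx n m) ℂ)) else 0) • (X x : MvPolynomial (MatIdx m) (MvPolynomial (BlockIdx n m) ℂ)) +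
        (if h : (ofLex w).1 = (ofLex w).2 ∧ m - n ≤ ((ofLex w).1 : ℕ) then (X ⟨(ofLex w).1, h.2⟩ : (MvPolynomial (BlockIdx n m) ℂ))
          else 0) • (X y : MvPolynomial (MatIdx m) (MvPolynomial (BlockIdx n m) ℂ)) := fun w => by
    rw [hP]; exact pp_linSubst_pencil_X hyx w
  -- base change of the padded permanent
  have hmap : map (algebraMap ℂ (MvPolynomial (BlockIdx n m) ℂ)) (paddedPerFormLex ℂ n m) =
      rename toLex (X ((0 : Fin m), (0 : Fin m)) ^ (m - n) *
        rename (fun ij : BlockIdx n m × BlockIdx n m => ((ij.1 : Fin m), (ij.2 : Fin m)))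
          (perPoly (BlockIdx n m) (MvPolynomial (BlockIdx n m) ℂ))) := by
    rw [paddedPerFormLex, paddedPerPoly, map_rename, map_mul, map_pow, map_X, map_rename, map_perPoly]
  rw [hmap, map_mul, map_pow]
  -- (`rename` is now distributed; `linSubst` is distributed below)
  -- the padding variable
  have h00 : linSubst (MatIdx m) (MvPolynomial (BlockIdx n m) ℂ) P (rename toLex (X ((0 : Fin m), (0 : Fin m)))) ^ (m - n) =
      (X x : MvPolynomial (MatIdx m) (MvPolynomial (BlockIdx n m) ℂ)) ^ (m - n) := by
    rw [rename_X, hX]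
    obtain hmn | hmn := Nat.eq_zero_or_pos (m - n)
    · simp [hmn]
    · have hc : ¬ ((ofLex (toLex ((0 : Fin m), (0 : Fin m)))).1 = (ofLex (toLex ((0 : Fin m), (0 : Fin m)))).2 ∧
          m - n ≤ (((ofLex (toLex ((0 : Fin m), (0 : Fin m)))).1 : Fin m) : ℕ)) := by
        simp only [ofLex_toLex]
        rintro ⟨_, h⟩
        simp at h
        omega
      rw [dif_neg hc]
      simp
  rw [map_mul, map_pow, h00]
  congr 1
  -- the permanent of the block: a diagonal matrix
  rw [perPoly, show (Matrix.mvPolynomialX (BlockIdx n m) (BlockIdx n m) (MvPolynomial (BlockIdx n m) ℂ)).permanent =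
      ∑ π : Equiv.Perm (BlockIdx n m), ∏ t, (X (π t, t) : MvPolynomial (BlockIdx n m × BlockIdx n m) (MvPolynomial (BlockIdx n m) ℂ))
      from rfl]
  simp only [map_sum, map_prod, rename_X, hX]
  have hdiag : (∑ π : Equiv.Perm (BlockIdx n m), ∏ t : BlockIdx n m,
      ((if (ofLex (toLex (((π t : BlockIdx n m) : Fin m), ((t : BlockIdx n m) : Fin m)))).1 =
            (ofLex (toLex (((π t : BlockIdx n m) : Fin m), ((t : BlockIdx n m) : Fin m)))).2
          then (1 : (MvPolynomial (BlockIdx n m) ℂ)) else 0) • (X x : MvPolynomial (MatIdx m) (MvPolynomial (BlockIdx n m) ℂ)) +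
        (if h : (ofLex (toLex (((π t : BlockIdx n m) : Fin m), ((t : BlockIdx n m) : Fin m)))).1 =
              (ofLex (toLex (((π t : BlockIdx n m) : Fin m), ((t : BlockIdx n m) : Fin m)))).2 ∧
            m - n ≤ (((ofLex (toLex (((π t : BlockIdx n m) : Fin m), ((t : BlockIdx n m) : Fin m)))).1 : Fin m) : ℕ)
          then (X ⟨(ofLex (toLex (((π t : BlockIdx n m) : Fin m), ((t : BlockIdx n m) : Fin m)))).1, h.2⟩ : (MvPolynomial (BlockIdx n m) ℂ))
          else 0) • (X y : MvPolynomial (MatIdx m) (MvPolynomial (BlockIdx n m) ℂ)))) =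
      (Matrix.diagonal fun t : BlockIdx n m => (X x : MvPolynomial (MatIdx m) (MvPolynomial (BlockIdx n m) ℂ)) +
          C (X t : (MvPolynomial (BlockIdx n m) ℂ)) * (X y : MvPolynomial (MatIdx m) (MvPolynomial (BlockIdx n m) ℂ))).permanent := by
    rw [Matrix.permanent]
    refine Finset.sum_congr rfl fun π _ => Finset.prod_congr rfl fun t _ => ?_
    simp only [ofLex_toLex]
    by_cases hπ : π t = t
    · rw [hπ, Matrix.diagonal_apply_eq, if_pos rfl, dif_pos ⟨rfl, t.2⟩, one_smul, smul_eq_C_mul]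
    · have hne : ((π t : BlockIdx n m) : Fin m) ≠ ((t : BlockIdx n m) : Fin m) :=
        fun h => hπ (Subtype.ext h)
      rw [Matrix.diagonal_apply_ne _ hπ, if_neg hne, dif_neg (fun h => hne h.1), zero_smul, zero_smul,
        add_zero]
  rw [hdiag, Matrix.permanent_diagonal]

/-! ## Coefficients of the pencil: elementary symmetric polynomials -/

/-- Two-letter exponent vectors are determined by their two entries (`y ≠ x`). [folklore] -/
theorem pp_single_add_single_inj {m : ℕ} {x y : MatIdx m} (hyx : y ≠ x) (a b a' b' : ℕ) :
    (Finsupp.single y a + Finsupp.single x b : MatIdx m →₀ ℕ) = Finsupp.single y a' + Finsupp.single x b' ↔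
      a = a' ∧ b = b' := by
  constructor
  · intro h
    have h0 := congrArg (fun e => e y) h
    have h1 := congrArg (fun e => e x) h
    simp only [Finsupp.coe_add, Pi.add_apply, Finsupp.single_apply, if_neg hyx, if_neg hyx.symm] at h0 h1
    simp at h0 h1
    exact ⟨h0, h1⟩
  · rintro ⟨rfl, rfl⟩
    rfl

/-- Coefficients of `c · X_y^a X_x^b` over any commutative semiring. [folklore] -/
theorem pp_coeff_C_mul {m : ℕ} {x y : MatIdx m} (hyx : y ≠ x) {R : Type*} [CommSemiring R] (c : R)
    (a b r s : ℕ) :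
    coeff (Finsupp.single y r + Finsupp.single x s)
        (C c * ((X y : MvPolynomial (MatIdx m) R) ^ a * (X x : MvPolynomial (MatIdx m) R) ^ b)) =
      if a = r ∧ b = s then c else 0 := by
  rw [X_pow_eq_monomial, X_pow_eq_monomial, monomial_mul, one_mul, C_mul_monomial, mul_one,
    coeff_monomial]
  simp only [pp_single_add_single_inj hyx]

/-- **Expansion of the pencil form**: `X_x^{m-n} ∏_t (X_x + a_t X_y) = ∑_T e_T X_y^{|T|} X_x^{m-|T|}`
(`e_T = ∏_{t ∈ T} a_t`, `T` over the subsets of the block). [folklore] -/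
theorem pp_pencil_expand (n m : ℕ) [NeZero m] (hnm : n ≤ m) (x y : MatIdx m) :
    (X x : MvPolynomial (MatIdx m) (MvPolynomial (BlockIdx n m) ℂ)) ^ (m - n) *
        ∏ t : BlockIdx n m, ((X x : MvPolynomial (MatIdx m) (MvPolynomial (BlockIdx n m) ℂ)) +
          C (X t : (MvPolynomial (BlockIdx n m) ℂ)) * (X y : MvPolynomial (MatIdx m) (MvPolynomial (BlockIdx n m) ℂ))) =
      ∑ T ∈ (Finset.univ : Finset (BlockIdx n m)).powerset,
        C (∏ t ∈ T, (X t : (MvPolynomial (BlockIdx n m) ℂ))) *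
          ((X y : MvPolynomial (MatIdx m) (MvPolynomial (BlockIdx n m) ℂ)) ^ T.card *
            (X x : MvPolynomial (MatIdx m) (MvPolynomial (BlockIdx n m) ℂ)) ^ (m - T.card)) := by
  have hcomm : ∀ t : BlockIdx n m, ((X x : MvPolynomial (MatIdx m) (MvPolynomial (BlockIdx n m) ℂ)) +
      C (X t : (MvPolynomial (BlockIdx n m) ℂ)) * (X y : MvPolynomial (MatIdx m) (MvPolynomial (BlockIdx n m) ℂ))) =
      C (X t : (MvPolynomial (BlockIdx n m) ℂ)) * (X y : MvPolynomial (MatIdx m) (MvPolynomial (BlockIdx n m) ℂ)) + (X x : MvPolynomial (MatIdx m) (MvPolynomial (BlockIdx n m) ℂ)) :=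
    fun t => add_comm _ _
  simp only [hcomm]
  rw [Finset.prod_add, Finset.mul_sum]
  refine Finset.sum_congr rfl fun T hT => ?_
  have hcard : T.card ≤ n := by
    have := Finset.card_le_univ T
    rwa [card_blockIdx hnm] at this
  rw [Finset.prod_mul_distrib, Finset.prod_const, Finset.prod_const, Finset.card_univ_sdiff,
    card_blockIdx hnm, map_prod]
  have he : m - n + (n - T.card) = m - T.card := by omega
  rw [← he, pow_add]
  ring

/-- **Coefficients of the pencil form are the elementary symmetric polynomials**: for `j ≤ n`,
`coeff_{y^j x^{m-j}} (X_x^{m-n} ∏_t (X_x + a_t X_y)) = e_j(a)`. [folklore] -/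
theorem pp_coeff_pencil (n m : ℕ) [NeZero m] (hnm : n ≤ m) {x y : MatIdx m} (hyx : y ≠ x) (j : ℕ) :
    coeff (Finsupp.single y j + Finsupp.single x (m - j))
        ((X x : MvPolynomial (MatIdx m) (MvPolynomial (BlockIdx n m) ℂ)) ^ (m - n) *
          ∏ t : BlockIdx n m, ((X x : MvPolynomial (MatIdx m) (MvPolynomial (BlockIdx n m) ℂ)) +
            C (X t : (MvPolynomial (BlockIdx n m) ℂ)) * (X y : MvPolynomial (MatIdx m) (MvPolynomial (BlockIdx n m) ℂ)))) =
      MvPolynomial.esymm (BlockIdx n m) ℂ j := by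
  rw [pp_pencil_expand n m hnm x y, coeff_sum]
  simp only [pp_coeff_C_mul hyx]
  rw [MvPolynomial.esymm, Finset.powersetCard_eq_filter, Finset.sum_filter]
  refine Finset.sum_congr rfl fun T hT => ?_
  have hcard : T.card ≤ n := by
    have := Finset.card_le_univ T
    rwa [card_blockIdx hnm] at this
  by_cases h : T.card = j
  · rw [if_pos ⟨h, by rw [h]⟩, if_pos h]
  · rw [if_neg (fun h' => h h'.1), if_neg h]

end

end Summit.ValiantsHypothesis.ValiantsHypothesis.Theorems.ValuativeFlip
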